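import Summits.AtomisticToContinuum.Crystallization.Theorems.FrustratedLawDichotomyPalmStress

/-!
# FrustratedLawDichotomy · crux `AperiodicFrustratedLawGap` (stmt-AtomisticToContinuum-27623) — BORN STABILITY OF MINIMISING LAWS, I:
# second derivative of the deformed pair term (decomp-a2c, prover hand 2, structural share, generation 2)

Second-order companion of `FrustratedLawDichotomyPalmStress` (zero Palm stress = first order).  For `H ∈ End(ℝ³)`, `v = s + tHs`:
`d²/dt² V_LJ(‖v‖) = (14‖v‖⁻¹⁶ − 8‖v‖⁻¹⁰)⟨v, Hs⟩² + (‖v‖⁻⁸ − ‖v‖⁻¹⁴)‖Hs‖²` (`hasDerivAt_pairDeriv`), bounded for `|t|‖H‖ ≤ 1/2` by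
`‖H‖²(245760 ‖s‖⁻¹² + 2304 ‖s‖⁻⁶)` (`pairDeriv2_bound`), whence the configuration-level differentiation under the sum
`hasDerivAt_pairDerivSum` (dominated convergence), and the calculus lemma `second_deriv_nonneg_of_isLocalMin` (a local minimum of a function
differentiable near `0` whose derivative is differentiable at `0` has non-negative second derivative there; by the mean value theorem).
Part II (`FrustratedLawDichotomyBornStability`) differentiates under the law and concludes.  All `[folklore]`.
-/

noncomputable section

namespace Summit.AtomisticToContinuum.Crystallization.Theorems.FrustratedLawDichotomyPalmStress

open MeasureTheory Metric Set Filter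
open scoped ENNReal Topology BigOperators RealInnerProductSpace
open Literature.MathematicalPhysics.StatisticalMechanics Literature.Probability.Process
open Summit.AtomisticToContinuum.Crystallization.Theorems.ChargedEnergyGapNegative (E3 eStar)
open Summit.AtomisticToContinuum.Crystallization.Theorems.FrustratedLawDichotomyVirial (integrable_invPow)

/-! ## §1. A calculus lemma: second-order necessary condition at a local minimum -/

section Calculus

/-- **Second-order Fermat.**  If `f` has a local minimum at `0`, is differentiable on a ball about `0` with derivative `g`, and `g` is
differentiable at `0` with derivative `c`, then `0 ≤ c` (otherwise `g < 0` just right of `0` and, by the mean value theorem, `f` decreases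
there). [folklore] -/
theorem second_deriv_nonneg_of_isLocalMin {f g : ℝ → ℝ} {c ε : ℝ} (hε : 0 < ε) (hmin : IsLocalMin f 0)
    (hf : ∀ t ∈ ball (0 : ℝ) ε, HasDerivAt f (g t) t) (hg : HasDerivAt g c 0) : 0 ≤ c := by
  by_contra hc
  rw [not_le] at hc
  have hg0 : g 0 = 0 := hmin.hasDerivAt_eq_zero (hf 0 (mem_ball_self hε))
  have hslope : Tendsto (fun t => t⁻¹ * (g t - g 0)) (𝓝[≠] 0) (𝓝 c) := by
    simpa [slope_def_field, zero_add] using hasDerivAt_iff_tendsto_slope_zero.1 hg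
  have hev : ∀ᶠ t in 𝓝[≠] (0 : ℝ), t⁻¹ * (g t - g 0) < c / 2 := hslope (Iio_mem_nhds (by linarith))
  rw [eventually_nhdsWithin_iff, Metric.eventually_nhds_iff] at hev
  obtain ⟨η, hη, hηg⟩ := hev
  have hgneg : ∀ t : ℝ, 0 < t → t < η → g t < 0 := by
    intro t ht htη
    have h := hηg (by rwa [dist_zero_right, Real.norm_eq_abs, abs_of_pos ht]) (ne_of_gt ht)
    rw [hg0, sub_zero] at h
    have : t⁻¹ * g t < 0 := h.trans (by linarith)
    have hti : 0 < t⁻¹ := inv_pos.2 ht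
    nlinarith [mul_pos hti ht]
  obtain ⟨ρ, hρ, hρmin⟩ : ∃ ρ > 0, ∀ t ∈ ball (0 : ℝ) ρ, f 0 ≤ f t := by
    rcases Metric.eventually_nhds_iff.1 hmin with ⟨ρ, hρ, h⟩
    exact ⟨ρ, hρ, fun t ht => h ht⟩
  set t₀ : ℝ := min (min ε η) ρ / 2 with ht₀
  have ht₀pos : 0 < t₀ := by positivity
  have ht₀ε : t₀ < ε := by
    have : min (min ε η) ρ ≤ ε := (min_le_left _ _).trans (min_le_left _ _)
    rw [ht₀]; linarith
  have ht₀η : t₀ < η := by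
    have : min (min ε η) ρ ≤ η := (min_le_left _ _).trans (min_le_right _ _)
    rw [ht₀]; linarith
  have ht₀ρ : t₀ < ρ := by
    have : min (min ε η) ρ ≤ ρ := min_le_right _ _
    rw [ht₀]; linarith
  have hcont : ContinuousOn f (Icc 0 t₀) := by
    intro t ht
    exact (hf t (by rw [mem_ball, dist_zero_right, Real.norm_eq_abs, abs_of_nonneg ht.1]; linarith [ht.2])).continuousAt.continuousWithinAt
  have hdiff : ∀ t ∈ Ioo 0 t₀, HasDerivAt f (g t) t := fun t ht =>
    hf t (by rw [mem_ball, dist_zero_right, Real.norm_eq_abs, abs_of_pos ht.1]; linarith [ht.2])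
  obtain ⟨ξ, hξ, hξeq⟩ := exists_hasDerivAt_eq_slope f g ht₀pos hcont hdiff
  have hgξ : g ξ < 0 := hgneg ξ hξ.1 (hξ.2.trans ht₀η)
  have hft : f 0 ≤ f t₀ := hρmin t₀ (by rw [mem_ball, dist_zero_right, Real.norm_eq_abs, abs_of_pos ht₀pos]; exact ht₀ρ)
  rw [hξeq, sub_zero] at hgξ
  have : 0 ≤ (f t₀ - f 0) / t₀ := div_nonneg (by linarith) ht₀pos.le
  linarith

end Calculus

/-! ## §2. The second derivative of one deformed pair term -/

section PairTerm2

variable (H : E3 →L[ℝ] E3)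

/-- **Second derivative of the pair term**: for `v = s + tHs ≠ 0`,
`d/dt [(‖v‖⁻⁸ − ‖v‖⁻¹⁴)⟨v, Hs⟩] = (14‖v‖⁻¹⁶ − 8‖v‖⁻¹⁰)⟨v, Hs⟩² + (‖v‖⁻⁸ − ‖v‖⁻¹⁴)‖Hs‖²`. [folklore] -/
theorem hasDerivAt_pairDeriv_of_ne (s : E3) {t : ℝ} (hv : s + t • H s ≠ 0) :
    HasDerivAt (fun t : ℝ => (‖s + t • H s‖⁻¹ ^ 8 - ‖s + t • H s‖⁻¹ ^ 14) * ⟪s + t • H s, H s⟫)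
      ((14 * ‖s + t • H s‖⁻¹ ^ 16 - 8 * ‖s + t • H s‖⁻¹ ^ 10) * ⟪s + t • H s, H s⟫ ^ 2 +
        (‖s + t • H s‖⁻¹ ^ 8 - ‖s + t • H s‖⁻¹ ^ 14) * ‖H s‖ ^ 2) t := by
  have hf : HasDerivAt (fun t : ℝ => s + t • H s) (H s) t := by
    simpa using ((hasDerivAt_id t).smul_const (H s)).const_add s
  have hq : HasDerivAt (fun t : ℝ => ‖s + t • H s‖ ^ 2) (2 * ⟪s + t • H s, H s⟫) t := hf.norm_sq
  have hw : HasDerivAt (fun t : ℝ => ⟪s + t • H s, H s⟫) (‖H s‖ ^ 2) t := by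
    have h := hf.inner ℝ (hasDerivAt_const t (H s))
    simpa [real_inner_self_eq_norm_sq] using h
  set u : ℝ := ‖s + t • H s‖ ^ 2 with hu
  have hu0 : u ≠ 0 := by positivity
  have hinv : HasDerivAt (fun u : ℝ => u⁻¹) (-(u ^ 2)⁻¹) u := hasDerivAt_inv hu0
  have hΨ : HasDerivAt (fun u : ℝ => u⁻¹ ^ 4 - u⁻¹ ^ 7)
      (((4 : ℕ) * u⁻¹ ^ (4 - 1) * (-(u ^ 2)⁻¹)) - ((7 : ℕ) * u⁻¹ ^ (7 - 1) * (-(u ^ 2)⁻¹))) u :=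
    (hinv.fun_pow 4).sub (hinv.fun_pow 7)
  have hA := hΨ.comp t hq
  have hfun : (fun t : ℝ => (‖s + t • H s‖⁻¹ ^ 8 - ‖s + t • H s‖⁻¹ ^ 14) * ⟪s + t • H s, H s⟫) =
      fun t : ℝ => ((fun u : ℝ => u⁻¹ ^ 4 - u⁻¹ ^ 7) ∘ fun t : ℝ => ‖s + t • H s‖ ^ 2) t * ⟪s + t • H s, H s⟫ := by
    funext t'
    simp only [Function.comp_apply]
    rw [← inv_pow, ← pow_mul, ← pow_mul]
  rw [hfun]
  refine (hA.mul hw).congr_deriv ?_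
  have hu' : u⁻¹ = ‖s + t • H s‖⁻¹ ^ 2 := by rw [hu, inv_pow]
  have hu2 : (u ^ 2)⁻¹ = (‖s + t • H s‖⁻¹ ^ 2) ^ 2 := by rw [← inv_pow, hu']
  simp only [Function.comp_apply]
  rw [hu2, hu']
  push_cast
  ring

/-- **Second derivative of the pair term for `|t|‖H‖ ≤ 1/2` and every `s`** (at `s = 0` both sides vanish). [folklore] -/
theorem hasDerivAt_pairDeriv {t : ℝ} (ht : |t| * ‖H‖ ≤ 1 / 2) (s : E3) :
    HasDerivAt (fun t : ℝ => (‖s + t • H s‖⁻¹ ^ 8 - ‖s + t • H s‖⁻¹ ^ 14) * ⟪s + t • H s, H s⟫)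
      ((14 * ‖s + t • H s‖⁻¹ ^ 16 - 8 * ‖s + t • H s‖⁻¹ ^ 10) * ⟪s + t • H s, H s⟫ ^ 2 +
        (‖s + t • H s‖⁻¹ ^ 8 - ‖s + t • H s‖⁻¹ ^ 14) * ‖H s‖ ^ 2) t := by
  by_cases hs : s = 0
  · subst hs
    have hfun : (fun t : ℝ => (‖(0 : E3) + t • H 0‖⁻¹ ^ 8 - ‖(0 : E3) + t • H 0‖⁻¹ ^ 14) * ⟪(0 : E3) + t • H 0, H 0⟫) = fun _ => 0 := by
      funext t'; simp
    rw [hfun]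
    simpa using hasDerivAt_const t (0 : ℝ)
  · refine hasDerivAt_pairDeriv_of_ne H s ?_
    have hlo := (norm_deformed_bounds H ht s).1
    have ha : 0 < ‖s‖ := norm_pos_iff.2 hs
    exact norm_pos_iff.1 (by linarith)

/-- **Bound on the second derivative term** for `|t|‖H‖ ≤ 1/2`:
`|(14‖v‖⁻¹⁶ − 8‖v‖⁻¹⁰)⟨v,Hs⟩² + (‖v‖⁻⁸ − ‖v‖⁻¹⁴)‖Hs‖²| ≤ ‖H‖²(245760 ‖s‖⁻¹² + 2304 ‖s‖⁻⁶)`. [folklore] -/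
theorem pairDeriv2_bound {t : ℝ} (ht : |t| * ‖H‖ ≤ 1 / 2) (s : E3) :
    |(14 * ‖s + t • H s‖⁻¹ ^ 16 - 8 * ‖s + t • H s‖⁻¹ ^ 10) * ⟪s + t • H s, H s⟫ ^ 2 +
        (‖s + t • H s‖⁻¹ ^ 8 - ‖s + t • H s‖⁻¹ ^ 14) * ‖H s‖ ^ 2| ≤
      ‖H‖ ^ 2 * (245760 * ‖s‖⁻¹ ^ 12 + 2304 * ‖s‖⁻¹ ^ 6) := by
  obtain ⟨hlo, hhi⟩ := norm_deformed_bounds H ht s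
  have hH : 0 ≤ ‖H‖ := norm_nonneg H
  by_cases hs : s = 0
  · subst hs; simp
  have ha : 0 < ‖s‖ := norm_pos_iff.2 hs
  set a : ℝ := ‖s‖ with ha_def
  set r : ℝ := ‖s + t • H s‖ with hr_def
  have hr : 0 < r := lt_of_lt_of_le (by positivity) hlo
  have hinv : r⁻¹ ≤ 2 * a⁻¹ := by
    rw [show 2 * a⁻¹ = (a / 2)⁻¹ by rw [inv_div]; ring]
    exact (inv_le_inv₀ hr (by positivity)).2 hlo
  have hinv0 : 0 ≤ r⁻¹ := inv_nonneg.2 hr.le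
  have hpow : ∀ n : ℕ, r⁻¹ ^ n ≤ 2 ^ n * a⁻¹ ^ n := fun n => by
    rw [← mul_pow]; exact pow_le_pow_left₀ hinv0 hinv n
  have ha0 : 0 ≤ a⁻¹ := inv_nonneg.2 ha.le
  -- `⟨v, Hs⟩² ≤ r² ‖H‖² a²` and `‖Hs‖² ≤ ‖H‖² a²`
  have hHs : ‖H s‖ ≤ ‖H‖ * a := H.le_opNorm s
  have hw2 : ⟪s + t • H s, H s⟫ ^ 2 ≤ r ^ 2 * (‖H‖ * a) ^ 2 := by
    have h1 : |⟪s + t • H s, H s⟫| ≤ r * (‖H‖ * a) :=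
      (abs_real_inner_le_norm _ _).trans (mul_le_mul_of_nonneg_left hHs (norm_nonneg _))
    have h2 : 0 ≤ r * (‖H‖ * a) := by positivity
    calc ⟪s + t • H s, H s⟫ ^ 2 = |⟪s + t • H s, H s⟫| ^ 2 := (sq_abs _).symm
      _ ≤ (r * (‖H‖ * a)) ^ 2 := pow_le_pow_left₀ (abs_nonneg _) h1 2
      _ = r ^ 2 * (‖H‖ * a) ^ 2 := by ring
  have hn2 : ‖H s‖ ^ 2 ≤ (‖H‖ * a) ^ 2 := pow_le_pow_left₀ (norm_nonneg _) hHs 2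
  -- termwise
  have hr0 : r ≠ 0 := hr.ne'
  have e16 : r⁻¹ ^ 16 * r ^ 2 = r⁻¹ ^ 14 := by
    rw [show (16 : ℕ) = 14 + 2 by norm_num, pow_add, mul_assoc, ← mul_pow, inv_mul_cancel₀ hr0, one_pow, mul_one]
  have e10 : r⁻¹ ^ 10 * r ^ 2 = r⁻¹ ^ 8 := by
    rw [show (10 : ℕ) = 8 + 2 by norm_num, pow_add, mul_assoc, ← mul_pow, inv_mul_cancel₀ hr0, one_pow, mul_one]
  have h14 := hpow 14
  have h8 := hpow 8
  have h14' : 0 ≤ r⁻¹ ^ 14 := pow_nonneg hinv0 14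
  have h8' : 0 ≤ r⁻¹ ^ 8 := pow_nonneg hinv0 8
  have h16' : 0 ≤ r⁻¹ ^ 16 := pow_nonneg hinv0 16
  have h10' : 0 ≤ r⁻¹ ^ 10 := pow_nonneg hinv0 10
  -- `a⁻¹^14 a² = a⁻¹^12`, `a⁻¹^8 a² = a⁻¹^6`
  have ha' : a ≠ 0 := ha.ne'
  have f14 : a⁻¹ ^ 14 * a ^ 2 = a⁻¹ ^ 12 := by
    rw [show (14 : ℕ) = 12 + 2 by norm_num, pow_add, mul_assoc, ← mul_pow, inv_mul_cancel₀ ha', one_pow, mul_one]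
  have f8 : a⁻¹ ^ 8 * a ^ 2 = a⁻¹ ^ 6 := by
    rw [show (8 : ℕ) = 6 + 2 by norm_num, pow_add, mul_assoc, ← mul_pow, inv_mul_cancel₀ ha', one_pow, mul_one]
  rw [abs_le]
  constructor
  · -- lower bound: the negative parts are `-8 r⁻¹^10 w²` and `-r⁻¹^14 ‖Hs‖²`
    have t1 : 8 * r⁻¹ ^ 10 * ⟪s + t • H s, H s⟫ ^ 2 ≤ 8 * (2 ^ 8 * a⁻¹ ^ 8) * (‖H‖ * a) ^ 2 := by
      calc 8 * r⁻¹ ^ 10 * ⟪s + t • H s, H s⟫ ^ 2 ≤ 8 * r⁻¹ ^ 10 * (r ^ 2 * (‖H‖ * a) ^ 2) :=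
            mul_le_mul_of_nonneg_left hw2 (by positivity)
        _ = 8 * (r⁻¹ ^ 10 * r ^ 2) * (‖H‖ * a) ^ 2 := by ring
        _ = 8 * r⁻¹ ^ 8 * (‖H‖ * a) ^ 2 := by rw [e10]
        _ ≤ 8 * (2 ^ 8 * a⁻¹ ^ 8) * (‖H‖ * a) ^ 2 := by gcongr
    have t2 : r⁻¹ ^ 14 * ‖H s‖ ^ 2 ≤ (2 ^ 14 * a⁻¹ ^ 14) * (‖H‖ * a) ^ 2 :=
      mul_le_mul h14 hn2 (by positivity) (by positivity)
    have t3 : 0 ≤ 14 * r⁻¹ ^ 16 * ⟪s + t • H s, H s⟫ ^ 2 := by positivity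
    have t4 : 0 ≤ r⁻¹ ^ 8 * ‖H s‖ ^ 2 := by positivity
    have e1 : 8 * (2 ^ 8 * a⁻¹ ^ 8) * (‖H‖ * a) ^ 2 = ‖H‖ ^ 2 * (2048 * a⁻¹ ^ 6) := by
      rw [show 8 * (2 ^ 8 * a⁻¹ ^ 8) * (‖H‖ * a) ^ 2 = ‖H‖ ^ 2 * (2048 * (a⁻¹ ^ 8 * a ^ 2)) by ring, f8]
    have e2 : (2 ^ 14 * a⁻¹ ^ 14) * (‖H‖ * a) ^ 2 = ‖H‖ ^ 2 * (16384 * a⁻¹ ^ 12) := by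
      rw [show (2 ^ 14 * a⁻¹ ^ 14) * (‖H‖ * a) ^ 2 = ‖H‖ ^ 2 * (16384 * (a⁻¹ ^ 14 * a ^ 2)) by ring, f14]
    have hp12 : 0 ≤ a⁻¹ ^ 12 := pow_nonneg ha0 12
    have hp6 : 0 ≤ a⁻¹ ^ 6 := pow_nonneg ha0 6
    nlinarith [sq_nonneg ‖H‖]
  · -- upper bound: the positive parts are `14 r⁻¹^16 w²` and `r⁻¹^8 ‖Hs‖²`
    have t1 : 14 * r⁻¹ ^ 16 * ⟪s + t • H s, H s⟫ ^ 2 ≤ 14 * (2 ^ 14 * a⁻¹ ^ 14) * (‖H‖ * a) ^ 2 := by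
      calc 14 * r⁻¹ ^ 16 * ⟪s + t • H s, H s⟫ ^ 2 ≤ 14 * r⁻¹ ^ 16 * (r ^ 2 * (‖H‖ * a) ^ 2) :=
            mul_le_mul_of_nonneg_left hw2 (by positivity)
        _ = 14 * (r⁻¹ ^ 16 * r ^ 2) * (‖H‖ * a) ^ 2 := by ring
        _ = 14 * r⁻¹ ^ 14 * (‖H‖ * a) ^ 2 := by rw [e16]
        _ ≤ 14 * (2 ^ 14 * a⁻¹ ^ 14) * (‖H‖ * a) ^ 2 := by gcongr
    have t2 : r⁻¹ ^ 8 * ‖H s‖ ^ 2 ≤ (2 ^ 8 * a⁻¹ ^ 8) * (‖H‖ * a) ^ 2 :=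
      mul_le_mul h8 hn2 (by positivity) (by positivity)
    have t3 : 0 ≤ 8 * r⁻¹ ^ 10 * ⟪s + t • H s, H s⟫ ^ 2 := by positivity
    have t4 : 0 ≤ r⁻¹ ^ 14 * ‖H s‖ ^ 2 := by positivity
    have e1 : 14 * (2 ^ 14 * a⁻¹ ^ 14) * (‖H‖ * a) ^ 2 = ‖H‖ ^ 2 * (229376 * a⁻¹ ^ 12) := by
      rw [show 14 * (2 ^ 14 * a⁻¹ ^ 14) * (‖H‖ * a) ^ 2 = ‖H‖ ^ 2 * (229376 * (a⁻¹ ^ 14 * a ^ 2)) by ring, f14]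
    have e2 : (2 ^ 8 * a⁻¹ ^ 8) * (‖H‖ * a) ^ 2 = ‖H‖ ^ 2 * (256 * a⁻¹ ^ 6) := by
      rw [show (2 ^ 8 * a⁻¹ ^ 8) * (‖H‖ * a) ^ 2 = ‖H‖ ^ 2 * (256 * (a⁻¹ ^ 8 * a ^ 2)) by ring, f8]
    have hp12 : 0 ≤ a⁻¹ ^ 12 := pow_nonneg ha0 12
    have hp6 : 0 ≤ a⁻¹ ^ 6 := pow_nonneg ha0 6
    nlinarith [sq_nonneg ‖H‖]

/-- Measurability of the second-derivative term in `s`. [folklore] -/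
theorem measurable_pairDeriv2 (t : ℝ) :
    Measurable (fun s : E3 => (14 * ‖s + t • H s‖⁻¹ ^ 16 - 8 * ‖s + t • H s‖⁻¹ ^ 10) * ⟪s + t • H s, H s⟫ ^ 2 +
        (‖s + t • H s‖⁻¹ ^ 8 - ‖s + t • H s‖⁻¹ ^ 14) * ‖H s‖ ^ 2) := by
  have hv : Continuous fun s : E3 => s + t • H s := continuous_id.add (H.continuous.const_smul t)
  have hn : Measurable fun s : E3 => ‖s + t • H s‖⁻¹ := hv.norm.measurable.inv
  exact ((((hn.pow_const 16).const_mul 14).sub ((hn.pow_const 10).const_mul 8)).mul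
      ((hv.inner H.continuous).measurable.pow_const 2)).add
    (((hn.pow_const 8).sub (hn.pow_const 14)).mul (H.continuous.norm.measurable.pow_const 2))

end PairTerm2

/-! ## §3. Differentiating the first-derivative sum of a configuration once more -/

section Config2

variable (H : E3 →L[ℝ] E3) {δ : ℝ} {μ : Measure E3}

/-- **Second differentiation under the root sum**: for a rooted `δ`-hard-core `μ` and `t₀` in the ball `|t| < 1/(2(‖H‖+1))`,
`d/dt|_{t₀} Σ_s (‖v‖⁻⁸ − ‖v‖⁻¹⁴)⟨v, Hs⟩ = Σ_s [(14‖v‖⁻¹⁶ − 8‖v‖⁻¹⁰)⟨v, Hs⟩² + (‖v‖⁻⁸ − ‖v‖⁻¹⁴)‖Hs‖²]` (dominated convergence, dominating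
function `‖H‖²(245760‖s‖⁻¹² + 2304‖s‖⁻⁶)`), and the latter is integrable. [folklore] -/
theorem hasDerivAt_pairDerivSum (hδ : 0 < δ) (hμ : IsRootedHardCore δ μ) {t₀ : ℝ} (ht₀ : t₀ ∈ ball (0 : ℝ) (1 / (2 * (‖H‖ + 1)))) :
    Integrable (fun s : E3 => (14 * ‖s + t₀ • H s‖⁻¹ ^ 16 - 8 * ‖s + t₀ • H s‖⁻¹ ^ 10) * ⟪s + t₀ • H s, H s⟫ ^ 2 +
        (‖s + t₀ • H s‖⁻¹ ^ 8 - ‖s + t₀ • H s‖⁻¹ ^ 14) * ‖H s‖ ^ 2) μ ∧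
    HasDerivAt (fun t : ℝ => ∫ s, (‖s + t • H s‖⁻¹ ^ 8 - ‖s + t • H s‖⁻¹ ^ 14) * ⟪s + t • H s, H s⟫ ∂μ)
      (∫ s, (14 * ‖s + t₀ • H s‖⁻¹ ^ 16 - 8 * ‖s + t₀ • H s‖⁻¹ ^ 10) * ⟪s + t₀ • H s, H s⟫ ^ 2 +
        (‖s + t₀ • H s‖⁻¹ ^ 8 - ‖s + t₀ • H s‖⁻¹ ^ 14) * ‖H s‖ ^ 2 ∂μ) t₀ := by
  have hball : ball (0 : ℝ) (1 / (2 * (‖H‖ + 1))) ∈ 𝓝 t₀ := isOpen_ball.mem_nhds ht₀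
  obtain ⟨h6, h12⟩ := integrable_invPow hδ hμ
  have hb2 : Integrable (fun s : E3 => ‖H‖ ^ 2 * (245760 * ‖s‖⁻¹ ^ 12 + 2304 * ‖s‖⁻¹ ^ 6)) μ :=
    ((h12.const_mul _).add (h6.const_mul _)).const_mul _
  exact hasDerivAt_integral_of_dominated_loc_of_deriv_le (μ := μ) (x₀ := t₀)
    (F := fun (t : ℝ) (s : E3) => (‖s + t • H s‖⁻¹ ^ 8 - ‖s + t • H s‖⁻¹ ^ 14) * ⟪s + t • H s, H s⟫)
    (F' := fun (t : ℝ) (s : E3) => (14 * ‖s + t • H s‖⁻¹ ^ 16 - 8 * ‖s + t • H s‖⁻¹ ^ 10) * ⟪s + t • H s, H s⟫ ^ 2 +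
        (‖s + t • H s‖⁻¹ ^ 8 - ‖s + t • H s‖⁻¹ ^ 14) * ‖H s‖ ^ 2)
    (bound := fun s : E3 => ‖H‖ ^ 2 * (245760 * ‖s‖⁻¹ ^ 12 + 2304 * ‖s‖⁻¹ ^ 6)) hball
    (Eventually.of_forall fun t => (measurable_pairTerms H t).2.aestronglyMeasurable)
    (integrable_pairTerm H hδ hμ (abs_mul_norm_le_half_of_mem_ball H ht₀)).2
    (measurable_pairDeriv2 H t₀).aestronglyMeasurable
    (Eventually.of_forall fun s t ht => by
      rw [Real.norm_eq_abs]; exact pairDeriv2_bound H (abs_mul_norm_le_half_of_mem_ball H ht) s)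
    hb2
    (Eventually.of_forall fun s t ht => hasDerivAt_pairDeriv H (abs_mul_norm_le_half_of_mem_ball H ht) s)

end Config2

end Summit.AtomisticToContinuum.Crystallization.Theorems.FrustratedLawDichotomyPalmStress

end
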